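/-
Copyright (c) 2026. All rights reserved.
Released under Apache 2.0 license as described in the file LICENSE.
Authors: abc-iut cell, seat abc-iut-L5-t5 (wave 2, gen 2).
-/
import Literature.NumberTheory.NumberFields.RescaledCompletion
import Literature.IUT.LogThetaLattice.LocalLogShellsProofs
import Literature.IUT.LogVolume.FakeAdeleIndexLocalDegree
import HarnessLib

/-!
# `O_v ⊆ I_v` for the completion `K_v` of a number field and its `p_v`-adic logarithm ([IUTchIII] Rmk. 1.2.2 (i))

Proof-only file (theorems, no definitions). Let `F` be a number field, `v` a finite place,
`K_v = v.adicCompletion F`, `O_v = v.adicCompletionIntegers F`, `p_v = residueChar F v`.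
[IUTchIII] Rmk. 1.2.2 (i) (Mochizuki, *Inter-universal Teichmüller theory III*, kurims manuscript
p. 36; claim key Mochizuki2012) recalls, for the `p_v`-adic logarithm `log_v : O_v^× → K_v`, the inclusions
(b^non) `O_v^▷ ⊆ O_v ⊆ I_v := (p_v^*)⁻¹ · log_v(O_v^×)` — classical local analysis (Neukirch, *Algebraic
Number Theory*, Ch. II (5.5): the logarithmic series maps `1 + p^* O_v` onto `p^* O_v`; [AbsTopIII]
Def. 5.4 (iii); [IUTchIV] Prop. 1.2 (i)). The cell typed the second inclusion as the predicate
`Literature.IUT.LogThetaLattice.IntegersSubsetLogShell O logk p` over an ABSTRACT homomorphism `logk`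
(abc-iut-L6-t3, `LocalLogShells`) and discharged it for abc-iut-S1's analytic `unitLog` (abc-iut-L3-t11,
`LocalLogShellsProofs`) in the norm-side setting `[NormedAlgebra ℚ_[p] K] [IsUltrametricDist K]
[ProperSpace K]` — which Mathlib's `K_v` does not satisfy literally (`‖p‖_v = p^{-n_v}`; abc-iut-c312-5's
finding, 2026-08-25), so the `p_v`-adic logarithms stayed a BINDER `logv : PadicLogs F` in
`Summits/ABC/IUTFork/Thm311Real*.lean`, subject to the law `Real.LogvLaw` (`Thm311RealDH`).

abc-iut-S7's `Literature.NumberTheory.NumberFields.RescaledCompletion F p v hv` (p408146) is the field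
`K_v` re-normed by `‖·‖_v^{1/n_v}` — a normed `ℚ_p`-algebra, ultrametric, proper, complete, on the SAME
type with the same ring of integers and topology. This file runs L3-t11's discharge there and transports
it back to `K_v` along the identity (the predicate mentions only the sets `O_v` and
`(p^*)⁻¹ · log_v(O_v^×)`, not the norm):

* `mem_integers_iff_norm_rescaled_le_one` — `O_v` is the closed unit ball of the rescaled norm (the
  hypothesis `hO` of `LocalLogShellsProofs`);
* `exists_unitLog_integersSubsetLogShell` — for every prime `p` under `v`: there is
  `logk : Additive (O_v)ˣ →+ K_v`, GIVEN BY THE FORMULA `logk u = unitLog u` (S1's `p`-adic logarithm,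
  evaluated in the rescaled field), with `IntegersSubsetLogShell O_v logk p`;
* `exists_unitLog_integersSubsetLogShell_residueChar` — the same at `p = p_v` (no `Fact` hypothesis in
  the statement), together with the facts that pin `logk` down as THE analytic logarithm: on
  principal units `‖1 - u‖_v < 1` it is the logarithmic series `-∑ (1-u)ⁿ/n` (summed in the rescaled
  field, whose uniform structure is that of `K_v`), and it is a homomorphism (so
  `log_v(u) = k⁻¹ log_v(u^k)` reduces every unit to a principal one, `exists_pow_norm_one_sub_lt_one`);
  plus `log_v(torsion) = 0` and (c^non) `log_v(O_v^×) ⊆ I_v`;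
* `exists_logFamily_integersSubsetLogShell` — the family over all finite places (the shape of the binder
  `PadicLogs F`; consumer: abc-iut-c312-5's `Real.analyticLogv`, `Real.logvLaw_analyticLogv`).

No new definitions; nothing here is disputed mathematics; no side is taken on [IUTchIII] Cor. 3.12.
-/

noncomputable section

namespace Literature.IUT.LogVolume

open NumberField IsDedekindDomain Literature.IUT.LogThetaLattice
open Literature.NumberTheory.NumberFields

variable (F : Type) [Field F] [NumberField F] (p : ℕ) [hp : Fact p.Prime] (v : HeightOneSpectrum (𝓞 F))
  (hv : ((p : ℕ) : 𝓞 F) ∈ v.asIdeal)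

/-! ## 1. The ring of integers and the principal units under the rescaled norm -/

omit hp in
/-- `O_v = {‖x‖' ≤ 1}` for abc-iut-S7's rescaled norm `‖·‖' = ‖·‖_v^{1/n_v}` on `K_v` (both norms come
from the same valuation `Valued.v`; Mathlib `Valued.toNormedField.norm_le_one_iff`). This is the
hypothesis `hO` of `LocalLogShellsProofs` for `O := v.adicCompletionIntegers F` viewed in the rescaled
field. [cite: NeukirchANT1999, Ch. II Prop. (3.3)] -/
theorem mem_integers_iff_norm_rescaled_le_one (x : RescaledCompletion F p v hv) :
    x ∈ (v.adicCompletionIntegers F : ValuationSubring (RescaledCompletion F p v hv)) ↔ ‖x‖ ≤ 1 := by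
  rw [Valued.toNormedField.norm_le_one_iff]
  exact Iff.rfl

omit hp in
/-- A unit of `O_v` has `‖u‖_v = 1` (`‖u‖_v ≤ 1`, `‖u⁻¹‖_v ≤ 1`, product `1`).
[cite: NeukirchANT1999, Ch. II Prop. (3.3)] -/
theorem norm_coe_unit_adicCompletionIntegers (u : (↥(v.adicCompletionIntegers F))ˣ) :
    ‖((u : ↥(v.adicCompletionIntegers F)) : v.adicCompletion F)‖ = 1 := by
  set a : v.adicCompletion F := ((u : ↥(v.adicCompletionIntegers F)) : v.adicCompletion F) with ha
  set b : v.adicCompletion F := ((↑(u⁻¹) : ↥(v.adicCompletionIntegers F)) : v.adicCompletion F) with hb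
  have h1 : ‖a‖ ≤ 1 := Valued.toNormedField.norm_le_one_iff.mpr (u : ↥(v.adicCompletionIntegers F)).2
  have h2 : ‖b‖ ≤ 1 := Valued.toNormedField.norm_le_one_iff.mpr (↑(u⁻¹) : ↥(v.adicCompletionIntegers F)).2
  have h12 : ‖a‖ * ‖b‖ = 1 := by
    rw [← norm_mul, ha, hb, ← MulMemClass.coe_mul, Units.mul_inv, OneMemClass.coe_one, norm_one]
  have ha0 : 0 ≤ ‖a‖ := norm_nonneg a
  have hb0 : 0 ≤ ‖b‖ := norm_nonneg b
  exact le_antisymm h1 (by nlinarith)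

omit hp in
/-- … hence also norm `1` for the rescaled norm (`1^{1/n_v} = 1`, abc-iut-S7's `norm_of`).
[cite: NeukirchANT1999, Ch. II Prop. (3.3)] -/
theorem norm_of_coe_unit_adicCompletionIntegers (u : (↥(v.adicCompletionIntegers F))ˣ) :
    ‖RescaledCompletion.of F p v hv ((((u : ↥(v.adicCompletionIntegers F))) : v.adicCompletion F))‖ = 1 := by
  rw [RescaledCompletion.norm_of, norm_coe_unit_adicCompletionIntegers, Real.one_rpow]

/-- A principal unit of `K_v` (`‖1 - u‖_v < 1`) is a principal unit for the rescaled norm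
(`‖·‖' = ‖·‖_v^{1/n_v}`). [cite: NeukirchANT1999, Ch. II Prop. (3.3)] -/
theorem isPrincipal_of_norm_one_sub_lt_one {u : v.adicCompletion F} (hu : ‖1 - u‖ < 1) :
    IsPrincipal (RescaledCompletion.of F p v hv u) := by
  show ‖RescaledCompletion.of F p v hv (1 - u)‖ < 1
  rw [RescaledCompletion.norm_of]
  exact Real.rpow_lt_one (norm_nonneg _) hu
    (div_pos one_pos (by exact_mod_cast localDeg_pos F v))

/-- Conversely, a principal unit for the rescaled norm is one for `‖·‖_v`. [cite: NeukirchANT1999, Ch. II Prop. (3.3)] -/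
theorem norm_one_sub_lt_one_of_isPrincipal {u : v.adicCompletion F}
    (hu : IsPrincipal (RescaledCompletion.of F p v hv u)) : ‖1 - u‖ < 1 := by
  change ‖RescaledCompletion.of F p v hv (1 - u)‖ < 1 at hu
  rw [RescaledCompletion.norm_of] at hu
  have hn : (0 : ℝ) < 1 / (localDeg F v : ℝ) :=
    div_pos one_pos (by exact_mod_cast localDeg_pos F v)
  by_contra h
  exact absurd hu (not_lt.mpr (Real.one_le_rpow (not_lt.mp h) hn.le))

/-- Every unit of `O_v` has a principal power: `‖1 - u^k‖_v < 1` for some `k ≥ 1` (abc-iut-S1's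
`exists_pow_isPrincipal` in the rescaled field, whose unit sphere and principal units are those of `K_v`).
[cite: NeukirchANT1999, Ch. II Prop. (5.3)] -/
theorem exists_pow_norm_one_sub_lt_one (u : (↥(v.adicCompletionIntegers F))ˣ) :
    ∃ k : ℕ, 0 < k ∧ ‖1 - (((u : ↥(v.adicCompletionIntegers F)) : v.adicCompletion F)) ^ k‖ < 1 := by
  haveI : Fact (residueChar F v).Prime := ⟨residueChar_prime F v⟩
  have hv' : ((residueChar F v : ℕ) : 𝓞 F) ∈ v.asIdeal := natCast_residueChar_mem F v
  obtain ⟨k, hk, hP⟩ :=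
    exists_pow_isPrincipal (norm_of_coe_unit_adicCompletionIntegers F (residueChar F v) v hv' u)
  exact ⟨k, hk, norm_one_sub_lt_one_of_isPrincipal F (residueChar F v) v hv' (by rwa [map_pow])⟩

/-! ## 2. The `p`-adic logarithm on `O_v^×` and `O_v ⊆ I_v` -/

/-- **[IUTchIII] Rmk. 1.2.2 (i) (b^non) for `K_v`, any prime `p` under `v`**: there is an additive
homomorphism `logk : O_v^× → K_v` — namely abc-iut-S1's `p`-adic logarithm `unitLog = log_p` (Neukirch II
(5.4)–(5.5)) evaluated in abc-iut-S7's rescaled field `K_v^{(1/n_v)}` (same elements as `K_v`; first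
clause) — with `O_v ⊆ I_v := (p^*)⁻¹ · logk(O_v^×)` (abc-iut-L6-t3's predicate `IntegersSubsetLogShell`,
DISCHARGED: abc-iut-L3-t11's `exists_logk_integersSubsetLogShell` in the rescaled field, read back in `K_v`
along the identity — the predicate mentions only the sets `O_v` and `(p^*)⁻¹ · logk(O_v^×)`).
"the evident inclusions `O_k^▷ ⊆ O_k ⊆ I_k`" [cite: Mochizuki2012, III Rmk 1.2.2 (i) p.36] -/
theorem exists_unitLog_integersSubsetLogShell :
    ∃ logk : Additive (↥(v.adicCompletionIntegers F))ˣ →+ v.adicCompletion F,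
      (∀ u : (↥(v.adicCompletionIntegers F))ˣ, logk (Additive.ofMul u) =
        (RescaledCompletion.of F p v hv).symm
          (unitLog (RescaledCompletion.of F p v hv (((u : ↥(v.adicCompletionIntegers F)) :
            v.adicCompletion F))))) ∧
      IntegersSubsetLogShell (v.adicCompletionIntegers F) logk p := by
  obtain ⟨logk, hlog, hI, -⟩ := exists_logk_integersSubsetLogShell p (K := RescaledCompletion F p v hv)
    (v.adicCompletionIntegers F : ValuationSubring (RescaledCompletion F p v hv))
    (mem_integers_iff_norm_rescaled_le_one F p v hv)
  exact ⟨logk, hlog, hI⟩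

/-- **On principal units the logarithm IS the logarithmic series**: for `logk` as in
`exists_unitLog_integersSubsetLogShell` (first clause) and a unit `u` of `O_v` with `‖1 - u‖_v < 1`,
`HasSum (n ↦ -(1-u)^{n+1}/(n+1)) (logk u)` — stated in the rescaled field `K_v^{(1/n_v)}`, whose elements
and uniform structure are those of `K_v` (abc-iut-S1's `hasSum_unitLog`; Neukirch II (5.4)). So `logk`,
being additive and every unit having a principal power (`exists_pow_norm_one_sub_lt_one`), is THE `p`-adic
logarithm `log_v` of Neukirch II (5.5). [cite: NeukirchANT1999, Ch. II Prop. (5.4)] -/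
theorem hasSum_of_eq_unitLog (logk : Additive (↥(v.adicCompletionIntegers F))ˣ →+ v.adicCompletion F)
    (hlog : ∀ u : (↥(v.adicCompletionIntegers F))ˣ, logk (Additive.ofMul u) =
      (RescaledCompletion.of F p v hv).symm
        (unitLog (RescaledCompletion.of F p v hv (((u : ↥(v.adicCompletionIntegers F)) :
          v.adicCompletion F)))))
    (u : (↥(v.adicCompletionIntegers F))ˣ)
    (hu : ‖1 - (((u : ↥(v.adicCompletionIntegers F)) : v.adicCompletion F))‖ < 1) :
    HasSum (fun n : ℕ => -((1 - RescaledCompletion.of F p v hv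
        (((u : ↥(v.adicCompletionIntegers F)) : v.adicCompletion F))) ^ (n + 1)) /
          (n + 1 : RescaledCompletion F p v hv))
      (RescaledCompletion.of F p v hv (logk (Additive.ofMul u))) := by
  rw [hlog u, RingEquiv.apply_symm_apply]
  exact hasSum_unitLog p (isPrincipal_of_norm_one_sub_lt_one F p v hv hu)

/-- **[IUTchIII] Rmk. 1.2.2 (i) (b^non) for `K_v` at its residue characteristic `p_v`** (no `Fact`
hypothesis in the statement): there is `logk : O_v^× → (K_v, +)` additive — abc-iut-S1's `unitLog` in the
rescaled field, first clause — with (1) `O_v ⊆ I_v = (p_v^*)⁻¹ · logk(O_v^×)` (`IntegersSubsetLogShell`,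
DISCHARGED), (2) `logk` kills the roots of unity of `O_v` ([IUTchIII] Rmk. 1.2.3 (i), characteristic `0`),
(3) (c^non) `logk(O_v^×) ⊆ I_v`. "the evident inclusions `O_k^▷ ⊆ O_k ⊆ I_k`"
[cite: Mochizuki2012, III Rmk 1.2.2 (i) p.36] -/
theorem exists_unitLog_integersSubsetLogShell_residueChar :
    ∃ logk : Additive (↥(v.adicCompletionIntegers F))ˣ →+ v.adicCompletion F,
      (∀ u : (↥(v.adicCompletionIntegers F))ˣ, logk (Additive.ofMul u) =
        (RescaledCompletion.of F (residueChar F v) v (natCast_residueChar_mem F v)).symm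
          (haveI : Fact (residueChar F v).Prime := ⟨residueChar_prime F v⟩
           unitLog (RescaledCompletion.of F (residueChar F v) v (natCast_residueChar_mem F v)
            (((u : ↥(v.adicCompletionIntegers F)) : v.adicCompletion F))))) ∧
      IntegersSubsetLogShell (v.adicCompletionIntegers F) logk (residueChar F v) ∧
      (∀ u : (↥(v.adicCompletionIntegers F))ˣ, IsOfFinOrder u → logk (Additive.ofMul u) = 0) ∧
      LogThetaLattice.logUnits (v.adicCompletionIntegers F : ValuationSubring (v.adicCompletion F)) logk ⊆
        nonarchLogShell (v.adicCompletionIntegers F) logk (residueChar F v) := by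
  haveI : Fact (residueChar F v).Prime := ⟨residueChar_prime F v⟩
  haveI : CharZero (v.adicCompletion F) :=
    Literature.NumberTheory.GaloisRepresentations.LocalField.charZero_adicCompletion v
  obtain ⟨logk, hlog, hI⟩ :=
    exists_unitLog_integersSubsetLogShell F (residueChar F v) v (natCast_residueChar_mem F v)
  exact ⟨logk, hlog, hI, fun u hu => log_eq_zero_of_isOfFinOrder _ _ u hu,
    logUnits_subset_nonarchLogShell _ _ _
      (Nat.cast_ne_zero.mpr (pStar_ne_zero (residueChar_prime F v).ne_zero))⟩

/-- **The family of `p_v`-adic logarithms with its law**: for a number field `F` there is a family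
`logv : ∀ v, Additive (O_v)ˣ →+ K_v` — at each `v` abc-iut-S1's `unitLog` in the rescaled field (first
clause) — with `IntegersSubsetLogShell O_v (logv v) p_v` at EVERY finite place: the shape of the binder
`PadicLogs F` and the law `Real.LogvLaw` of `Summits/ABC/IUTFork/Thm311Real(DH).lean` (abc-iut-c312-5),
which is thereby satisfiable by the analytic logarithms. "the evident inclusions `O_k^▷ ⊆ O_k ⊆ I_k`"
[cite: Mochizuki2012, III Rmk 1.2.2 (i) p.36] -/
theorem exists_logFamily_integersSubsetLogShell :
    ∃ logv : ∀ v : HeightOneSpectrum (𝓞 F),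
        Additive (↥(v.adicCompletionIntegers F))ˣ →+ v.adicCompletion F,
      ∀ v : HeightOneSpectrum (𝓞 F),
        (∀ u : (↥(v.adicCompletionIntegers F))ˣ, logv v (Additive.ofMul u) =
          (RescaledCompletion.of F (residueChar F v) v (natCast_residueChar_mem F v)).symm
            (haveI : Fact (residueChar F v).Prime := ⟨residueChar_prime F v⟩
             unitLog (RescaledCompletion.of F (residueChar F v) v (natCast_residueChar_mem F v)
              (((u : ↥(v.adicCompletionIntegers F)) : v.adicCompletion F))))) ∧
        IntegersSubsetLogShell (v.adicCompletionIntegers F) (logv v) (residueChar F v) :=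
  ⟨fun v => (exists_unitLog_integersSubsetLogShell_residueChar F v).choose, fun v =>
    ⟨(exists_unitLog_integersSubsetLogShell_residueChar F v).choose_spec.1,
      (exists_unitLog_integersSubsetLogShell_residueChar F v).choose_spec.2.1⟩⟩

end Literature.IUT.LogVolume
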